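import Summits.QuantumFields.GaugeBoot.FluctuationCentered
import HarnessLib

/-!
# Fluctuations of Wilson loops, V: block operators (gauge-boot, ADDENDUM 32 part E)

HONEST FRAMING (cell `pub-gaugeboot`, page 1 of every file): the venture produces certified bounds
on lattice expectations at stated coupling, gauge group, dimension and torus size; NOT a mass gap,
NOT a continuum limit, NOT a string tension; NOT Yang–Mills-summit-bearing (barriers
`FixedCouplingUltralocality`, `PerturbativeInvisibility`).  Strong-coupling `SO(N)` lattice gauge theory with free boundary
condition (S. Chatterjee, Comm. Math. Phys. **366** (2019); S. Chatterjee, J. Jafarov, arXiv:1604.04777); nothing about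
four-dimensional continuum Yang–Mills or a mass gap.

## Content

The four BLOCK OPERATORS of the loop equations acting on one block with a continuation `g` — split/deform `SD A g`, twist
`TW A g`, merge `ME A g`, cross-merge `XM A B g` (mergers between the blocks `A` and `B`; the merged loop replaces the loop of
the first operand, the remnants of the later block are appended to the earlier block) — are introduced as HYPOTHESISED
abbreviations (`hSD`, `hTW`, `hME`, `hXM`: no `def`), with: congruence and linearity in the continuation, the decomposition over a
concatenated block (`SD_append`, `TW_append`, `ME_append` — which produces `XM` — and `XM_append_left`, the last one up to a
permutation of the earlier block, for permutation-invariant continuations), a two-sided generic component sum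
(`compSum₂_cons`, `compSum₂_append`), and the peeling of the first centered block in block-indexed sums (`blockSum_cons`,
`xmSum_cons`, `doubleSum_cons`).  Pure bookkeeping for the centered-block loop equation.

Everything is `[folklore]`/`[new (lane)]` bookkeeping.
-/

noncomputable section

open Finset
open Literature.MathematicalPhysics.QuantumFieldTheory.Chatterjee2019LargeN
open Literature.MathematicalPhysics.QuantumFieldTheory.Chatterjee2019LargeN.Word

namespace Summit.QuantumFields.GaugeBoot

namespace StringDuality

variable {d : ℕ} {R : Type*} [CommRing R]

/-! ## Two-sided generic component sums -/

/-- Two-sided one-component sums of `w :: t` (the summand sees the prefix and the suffix around the component). [folklore] -/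
theorem compSum₂_cons (ι : List (DEdge d) → Type) [∀ w, Fintype (ι w)]
    (Φ : (w : List (DEdge d)) → ι w → LoopSeq d → LoopSeq d → R) (w : List (DEdge d)) (t : LoopSeq d) :
    (∑ i : Fin (w :: t).length, ∑ q : ι ((w :: t).get i), Φ _ q ((w :: t).take i) ((w :: t).drop (i + 1))) =
      (∑ q : ι w, Φ w q [] t) + ∑ i : Fin t.length, ∑ q : ι (t.get i), Φ _ q (w :: t.take i) (t.drop (i + 1)) := by
  refine (Fin.sum_univ_succ (fun i : Fin (t.length + 1) => ∑ q : ι ((w :: t).get i),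
    Φ _ q ((w :: t).take i) ((w :: t).drop (i + 1)))).trans ?_
  rfl

/-- Two-sided one-component sums of `A ++ B`. [folklore] -/
theorem compSum₂_append (ι : List (DEdge d) → Type) [∀ w, Fintype (ι w)]
    (Φ : (w : List (DEdge d)) → ι w → LoopSeq d → LoopSeq d → R) (A B : LoopSeq d) :
    (∑ i : Fin (A ++ B).length, ∑ q : ι ((A ++ B).get i), Φ _ q ((A ++ B).take i) ((A ++ B).drop (i + 1))) =
      (∑ i : Fin A.length, ∑ q : ι (A.get i), Φ _ q (A.take i) (A.drop (i + 1) ++ B)) +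
        ∑ i : Fin B.length, ∑ q : ι (B.get i), Φ _ q (A ++ B.take i) (B.drop (i + 1)) := by
  induction A generalizing Φ with
  | nil =>
    have h0 : (∑ i : Fin ([] : LoopSeq d).length, ∑ q : ι (([] : LoopSeq d).get i),
        Φ _ q (([] : LoopSeq d).take i) (([] : LoopSeq d).drop (i + 1) ++ B)) = 0 := Fin.sum_univ_zero _
    rw [h0, zero_add]
    rfl
  | cons w A ih =>
    have h1 := compSum₂_cons ι Φ w (A ++ B)
    have h2 := compSum₂_cons ι (fun w' q pre suf => Φ w' q pre (suf ++ B)) w A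
    have h3 := ih (fun w' q pre suf => Φ w' q (w :: pre) suf)
    refine h1.trans ?_
    rw [h3, h2, add_assoc]
    rfl

/-! ## The block operators -/

section ops

variable (b : R) (p : LoopSeq d → R)
  (SD TW ME : LoopSeq d → (LoopSeq d → R) → R) (XM : LoopSeq d → LoopSeq d → (LoopSeq d → R) → R)
  (hSD : ∀ (A : LoopSeq d) (g : LoopSeq d → R), SD A g =
    ((∑ o : InvIdx A, g (A.negSplitAt o)) - ∑ o : SameIdx A, g (A.posSplitAt o))
      + b * ((∑ o : DeformIdx A, g (A.negDeformAt o)) - ∑ o : DeformIdx A, g (A.posDeformAt o)))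
  (hTW : ∀ (A : LoopSeq d) (g : LoopSeq d → R), TW A g =
    (∑ o : SameIdx A, g (A.negTwistAt o)) - ∑ o : InvIdx A, g (A.posTwistAt o))
  (hME : ∀ (A : LoopSeq d) (g : LoopSeq d → R), ME A g =
    (∑ o : MergeIdx A, g (A.negMergeAt o)) - ∑ o : MergeIdx A, g (A.posMergeAt o))
  (hXM : ∀ (A B : LoopSeq d) (g : LoopSeq d → R), XM A B g =
    (∑ i : Fin A.length, ∑ j : Fin B.length,
        ∑ q : {xy : Fin (A.get i).length × Fin (B.get j).length // ((B.get j).get xy.2).1 = ((A.get i).get xy.1).1},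
          (g (A.take i ++ LoopSeq.prune [negMerge _ q.1.1 _ q.1.2] ++ A.drop (i + 1) ++ B.eraseIdx j)
            - g (A.take i ++ LoopSeq.prune [posMerge _ q.1.1 _ q.1.2] ++ A.drop (i + 1) ++ B.eraseIdx j)))
    + ∑ j : Fin B.length, ∑ i : Fin A.length,
        ∑ q : {xy : Fin (B.get j).length × Fin (A.get i).length // ((A.get i).get xy.2).1 = ((B.get j).get xy.1).1},
          (g (A.eraseIdx i ++ (B.take j ++ LoopSeq.prune [negMerge _ q.1.1 _ q.1.2] ++ B.drop (j + 1)))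
            - g (A.eraseIdx i ++ (B.take j ++ LoopSeq.prune [posMerge _ q.1.1 _ q.1.2] ++ B.drop (j + 1)))))
include hSD hTW hME hXM

/-! ### Congruence and linearity in the continuation -/
omit hTW hME hXM in
/-- [folklore] -/
theorem SD_congr (A : LoopSeq d) {g g' : LoopSeq d → R} (h : ∀ u, g u = g' u) : SD A g = SD A g' := by
  rw [hSD, hSD]; simp only [h]
omit hTW hME hXM in
/-- [folklore] -/
theorem SD_sub (A : LoopSeq d) (g h : LoopSeq d → R) : SD A (fun u => g u - h u) = SD A g - SD A h := by
  rw [hSD, hSD, hSD]; simp only [Finset.sum_sub_distrib]; ring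
omit hTW hME hXM in
/-- [folklore] -/
theorem SD_add (A : LoopSeq d) (g h : LoopSeq d → R) : SD A (fun u => g u + h u) = SD A g + SD A h := by
  rw [hSD, hSD, hSD]; simp only [Finset.sum_add_distrib]; ring
omit hTW hME hXM in
/-- [folklore] -/
theorem SD_mul_left (A : LoopSeq d) (c : R) (g : LoopSeq d → R) : SD A (fun u => c * g u) = c * SD A g := by
  rw [hSD, hSD]; simp only [← Finset.mul_sum]; ring
omit hTW hME hXM in
/-- [folklore] -/
theorem SD_mul_right (A : LoopSeq d) (c : R) (g : LoopSeq d → R) : SD A (fun u => g u * c) = SD A g * c := by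
  rw [hSD, hSD]; simp only [← Finset.sum_mul]; ring
omit hSD hME hXM in
/-- [folklore] -/
theorem TW_congr (A : LoopSeq d) {g g' : LoopSeq d → R} (h : ∀ u, g u = g' u) : TW A g = TW A g' := by
  rw [hTW, hTW]; simp only [h]
omit hSD hME hXM in
/-- [folklore] -/
theorem TW_sub (A : LoopSeq d) (g h : LoopSeq d → R) : TW A (fun u => g u - h u) = TW A g - TW A h := by
  rw [hTW, hTW, hTW]; simp only [Finset.sum_sub_distrib]; ring
omit hSD hME hXM in
/-- [folklore] -/
theorem TW_add (A : LoopSeq d) (g h : LoopSeq d → R) : TW A (fun u => g u + h u) = TW A g + TW A h := by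
  rw [hTW, hTW, hTW]; simp only [Finset.sum_add_distrib]; ring
omit hSD hME hXM in
/-- [folklore] -/
theorem TW_mul_left (A : LoopSeq d) (c : R) (g : LoopSeq d → R) : TW A (fun u => c * g u) = c * TW A g := by
  rw [hTW, hTW]; simp only [← Finset.mul_sum]; ring
omit hSD hME hXM in
/-- [folklore] -/
theorem TW_mul_right (A : LoopSeq d) (c : R) (g : LoopSeq d → R) : TW A (fun u => g u * c) = TW A g * c := by
  rw [hTW, hTW]; simp only [← Finset.sum_mul]; ring
omit hSD hTW hXM in
/-- [folklore] -/
theorem ME_congr (A : LoopSeq d) {g g' : LoopSeq d → R} (h : ∀ u, g u = g' u) : ME A g = ME A g' := by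
  rw [hME, hME]; simp only [h]
omit hSD hTW hXM in
/-- [folklore] -/
theorem ME_sub (A : LoopSeq d) (g h : LoopSeq d → R) : ME A (fun u => g u - h u) = ME A g - ME A h := by
  rw [hME, hME, hME]; simp only [Finset.sum_sub_distrib]; ring
omit hSD hTW hXM in
/-- [folklore] -/
theorem ME_add (A : LoopSeq d) (g h : LoopSeq d → R) : ME A (fun u => g u + h u) = ME A g + ME A h := by
  rw [hME, hME, hME]; simp only [Finset.sum_add_distrib]; ring
omit hSD hTW hXM in
/-- [folklore] -/
theorem ME_mul_left (A : LoopSeq d) (c : R) (g : LoopSeq d → R) : ME A (fun u => c * g u) = c * ME A g := by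
  rw [hME, hME]; simp only [← Finset.mul_sum]; ring
omit hSD hTW hXM in
/-- [folklore] -/
theorem ME_mul_right (A : LoopSeq d) (c : R) (g : LoopSeq d → R) : ME A (fun u => g u * c) = ME A g * c := by
  rw [hME, hME]; simp only [← Finset.sum_mul]; ring
omit hSD hTW hME in
/-- [folklore] -/
theorem XM_congr (A B : LoopSeq d) {g g' : LoopSeq d → R} (h : ∀ u, g u = g' u) : XM A B g = XM A B g' := by
  rw [hXM, hXM]; simp only [h]
omit hSD hTW hME in
/-- [folklore] -/
theorem XM_sub (A B : LoopSeq d) (g h : LoopSeq d → R) : XM A B (fun u => g u - h u) = XM A B g - XM A B h := by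
  rw [hXM, hXM, hXM]; simp only [Finset.sum_sub_distrib]; ring
omit hSD hTW hME in
/-- [folklore] -/
theorem XM_add (A B : LoopSeq d) (g h : LoopSeq d → R) : XM A B (fun u => g u + h u) = XM A B g + XM A B h := by
  rw [hXM, hXM, hXM]; simp only [Finset.sum_add_distrib, Finset.sum_sub_distrib]; ring
omit hSD hTW hME in
/-- [folklore] -/
theorem XM_mul_left (A B : LoopSeq d) (c : R) (g : LoopSeq d → R) : XM A B (fun u => c * g u) = c * XM A B g := by
  rw [hXM, hXM]; simp only [← mul_sub, ← Finset.mul_sum]; ring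

/-! ### The operators of the empty block vanish -/

omit hSD hTW hME hXM in
/-- Operation index types of the null loop sequence are empty. [folklore] -/
theorem sums_nil :
    (∀ f : InvIdx ([] : LoopSeq d) → R, ∑ o, f o = 0) ∧ (∀ f : SameIdx ([] : LoopSeq d) → R, ∑ o, f o = 0) ∧
      (∀ f : DeformIdx ([] : LoopSeq d) → R, ∑ o, f o = 0) ∧ (∀ f : MergeIdx ([] : LoopSeq d) → R, ∑ o, f o = 0) :=
  ⟨fun _ => Finset.sum_eq_zero fun o _ => o.1.elim0, fun _ => Finset.sum_eq_zero fun o _ => o.1.elim0,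
    fun _ => Finset.sum_eq_zero fun o _ => o.1.elim0, fun _ => Finset.sum_eq_zero fun o _ => o.1.elim0⟩

omit hTW hME hXM in
/-- [folklore] -/
theorem SD_nil (g : LoopSeq d → R) : SD [] g = 0 := by
  obtain ⟨h1, h2, h3, -⟩ := sums_nil (d := d) (R := R)
  rw [hSD, h1, h2, h3, h3]
  ring

omit hSD hME hXM in
/-- [folklore] -/
theorem TW_nil (g : LoopSeq d → R) : TW [] g = 0 := by
  obtain ⟨h1, h2, -, -⟩ := sums_nil (d := d) (R := R)
  rw [hTW, h1, h2, sub_zero]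

omit hSD hTW hXM in
/-- [folklore] -/
theorem ME_nil (g : LoopSeq d → R) : ME [] g = 0 := by
  obtain ⟨-, -, -, h4⟩ := sums_nil (d := d) (R := R)
  rw [hME, h4, h4, sub_zero]

/-! ### Decomposition over a concatenated block -/

omit hTW hME hXM in
/-- Splittings and deformations of a concatenated block. [cite: Chatterjee2019LargeN, §2.2 (componentwise operations)] -/
theorem SD_append {A B : LoopSeq d} (hA : ∀ l ∈ A, l ≠ []) (hB : ∀ l ∈ B, l ≠ []) (g : LoopSeq d → R) :
    SD (A ++ B) g = SD A (fun u => g (u ++ B)) + SD B (fun u => g (A ++ u)) := by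
  rw [hSD, hSD, hSD, sum_negSplitAt_append hA hB, sum_posSplitAt_append hA hB, sum_negDeformAt_append hA hB,
    sum_posDeformAt_append hA hB]
  ring

omit hSD hME hXM in
/-- Twistings of a concatenated block. [cite: Chatterjee2019LargeN, §2.2 (componentwise operations)] -/
theorem TW_append {A B : LoopSeq d} (hA : ∀ l ∈ A, l ≠ []) (hB : ∀ l ∈ B, l ≠ []) (g : LoopSeq d → R) :
    TW (A ++ B) g = TW A (fun u => g (u ++ B)) + TW B (fun u => g (A ++ u)) := by
  rw [hTW, hTW, hTW, sum_negTwistAt_append hA hB, sum_posTwistAt_append hA hB]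
  ring

omit hSD hTW in
/-- Mergers of a concatenated block: inside each part plus the CROSS mergers. [cite: Chatterjee2019LargeN, §2.2 (𝕄^±)] -/
theorem ME_append {A B : LoopSeq d} (hA : ∀ l ∈ A, l ≠ []) (hB : ∀ l ∈ B, l ≠ []) (g : LoopSeq d → R) :
    ME (A ++ B) g = ME A (fun u => g (u ++ B)) + ME B (fun u => g (A ++ u)) + XM A B g := by
  rw [hME, hME, hME, hXM, sum_negMergeAt_append hA hB, sum_posMergeAt_append hA hB]
  simp only [Finset.sum_sub_distrib]
  ring

omit hSD hTW hME hXM in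
/-- A pruned singleton of a loop is a genuine loop sequence. [folklore] -/
theorem isLoopSeq_prune_singleton {w : List (DEdge d)} (hw : IsLoop w) : IsLoopSeq (LoopSeq.prune [w]) :=
  LoopSeq.isLoopSeq_prune fun l hl => by
    simp only [List.mem_singleton] at hl
    rw [hl]; exact hw

omit hSD hTW hME hXM in
/-- Sublists by `take` / `drop` / `eraseIdx` of genuine loop sequences are genuine. [folklore] -/
theorem isLoopSeq_take_drop {A : LoopSeq d} (hA : IsLoopSeq A) (i j : ℕ) :
    IsLoopSeq (A.take i) ∧ IsLoopSeq (A.drop i) ∧ IsLoopSeq (A.eraseIdx j) :=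
  ⟨fun l hl => hA l (List.mem_of_mem_take hl), fun l hl => hA l (List.mem_of_mem_drop hl),
    fun l hl => hA l (List.mem_of_mem_eraseIdx hl)⟩

omit hSD hTW hME in
/-- **Cross mergers from a concatenated earlier block**, for a continuation invariant under permutations of genuine loop
sequences: the loops of `B` are moved past the remnants of `B'` (a permutation). [new (lane)] -/
theorem XM_append_left {A B B' : LoopSeq d} (hA : IsLoopSeq A) (hB : IsLoopSeq B) (hB' : IsLoopSeq B')
    (g : LoopSeq d → R) (hg : ∀ M M' : LoopSeq d, IsLoopSeq M → M.Perm M' → g M = g M') :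
    XM (A ++ B) B' g = XM A B' (fun M => g (M ++ B)) + XM B B' (fun M => g (A ++ M)) := by
  have hAn : ∀ l ∈ A, l ≠ [] := fun l hl => (hA l hl).2
  have hBn : ∀ l ∈ B, l ≠ [] := fun l hl => (hB l hl).2
  rw [hXM, hXM, hXM]
  -- first kind: the merged loop sits in the earlier block `A ++ B`, a loop of `B'` is erased
  have h1 :
      (∑ i : Fin (A ++ B).length, ∑ j : Fin B'.length,
        ∑ q : {xy : Fin ((A ++ B).get i).length × Fin (B'.get j).length // ((B'.get j).get xy.2).1 = (((A ++ B).get i).get xy.1).1},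
          (g ((A ++ B).take i ++ LoopSeq.prune [negMerge _ q.1.1 _ q.1.2] ++ (A ++ B).drop (i + 1) ++ B'.eraseIdx j)
            - g ((A ++ B).take i ++ LoopSeq.prune [posMerge _ q.1.1 _ q.1.2] ++ (A ++ B).drop (i + 1) ++ B'.eraseIdx j))) =
      (∑ i : Fin A.length, ∑ j : Fin B'.length,
        ∑ q : {xy : Fin (A.get i).length × Fin (B'.get j).length // ((B'.get j).get xy.2).1 = ((A.get i).get xy.1).1},
          (g (A.take i ++ LoopSeq.prune [negMerge _ q.1.1 _ q.1.2] ++ A.drop (i + 1) ++ B'.eraseIdx j ++ B)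
            - g (A.take i ++ LoopSeq.prune [posMerge _ q.1.1 _ q.1.2] ++ A.drop (i + 1) ++ B'.eraseIdx j ++ B)))
      + ∑ i : Fin B.length, ∑ j : Fin B'.length,
        ∑ q : {xy : Fin (B.get i).length × Fin (B'.get j).length // ((B'.get j).get xy.2).1 = ((B.get i).get xy.1).1},
          (g (A ++ (B.take i ++ LoopSeq.prune [negMerge _ q.1.1 _ q.1.2] ++ B.drop (i + 1) ++ B'.eraseIdx j))
            - g (A ++ (B.take i ++ LoopSeq.prune [posMerge _ q.1.1 _ q.1.2] ++ B.drop (i + 1) ++ B'.eraseIdx j))) := by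
    have e := compSum₂_append (fun _ => Fin B'.length)
      (fun w j pre suf => ∑ q : {xy : Fin w.length × Fin (B'.get j).length // ((B'.get j).get xy.2).1 = (w.get xy.1).1},
        (g (pre ++ LoopSeq.prune [negMerge w q.1.1 (B'.get j) q.1.2] ++ suf ++ B'.eraseIdx j)
          - g (pre ++ LoopSeq.prune [posMerge w q.1.1 (B'.get j) q.1.2] ++ suf ++ B'.eraseIdx j))) A B
    rw [e]
    congr 1
    · refine Finset.sum_congr rfl fun i _ => Finset.sum_congr rfl fun j _ => Finset.sum_congr rfl fun q _ => ?_
      -- move `B` past the remnants of `B'`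
      have hq : ((B'.get j).get q.1.2).1 = ((A.get i).get q.1.1).1 := q.2
      have gn : IsLoop (negMerge (A.get i) q.1.1 (B'.get j) q.1.2) :=
        Word.isLoop_negMerge (hA _ (List.get_mem A i)).1.1 (hB' _ (List.get_mem B' j)).1.1 hq
      have gp : IsLoop (posMerge (A.get i) q.1.1 (B'.get j) q.1.2) :=
        Word.isLoop_posMerge (hA _ (List.get_mem A i)).1.1 (hB' _ (List.get_mem B' j)).1.1 hq
      have hgen : ∀ w, IsLoop w → IsLoopSeq (A.take i ++ LoopSeq.prune [w] ++ (A.drop (i + 1) ++ B) ++ B'.eraseIdx j) :=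
        fun w hw => isLoopSeq_append (isLoopSeq_append (isLoopSeq_append (isLoopSeq_take_drop hA i 0).1
          (isLoopSeq_prune_singleton hw)) (isLoopSeq_append (isLoopSeq_take_drop hA (i + 1) 0).2.1 hB))
          (isLoopSeq_take_drop hB' 0 j).2.2
      have hperm : ∀ w : List (DEdge d), (A.take i ++ LoopSeq.prune [w] ++ (A.drop (i + 1) ++ B) ++ B'.eraseIdx j).Perm
          (A.take i ++ LoopSeq.prune [w] ++ A.drop (i + 1) ++ B'.eraseIdx j ++ B) := by
        intro w
        simp only [List.append_assoc]
        exact ((List.perm_append_comm (l₁ := B) (l₂ := B'.eraseIdx ↑j)).append_left (A.drop (i + 1))).append_left _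
          |>.append_left _
      rw [hg _ _ (hgen _ gn) (hperm _), hg _ _ (hgen _ gp) (hperm _)]
    · refine Finset.sum_congr rfl fun i _ => Finset.sum_congr rfl fun j _ => Finset.sum_congr rfl fun q _ => ?_
      simp only [List.append_assoc]
  -- second kind: a loop of the earlier block is erased, the merged loop sits in `B'`
  have h2 : ∀ j : Fin B'.length,
      (∑ i : Fin (A ++ B).length,
        ∑ q : {xy : Fin (B'.get j).length × Fin ((A ++ B).get i).length // (((A ++ B).get i).get xy.2).1 = ((B'.get j).get xy.1).1},
          (g ((A ++ B).eraseIdx i ++ (B'.take j ++ LoopSeq.prune [negMerge _ q.1.1 _ q.1.2] ++ B'.drop (j + 1)))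
            - g ((A ++ B).eraseIdx i ++ (B'.take j ++ LoopSeq.prune [posMerge _ q.1.1 _ q.1.2] ++ B'.drop (j + 1))))) =
      (∑ i : Fin A.length,
        ∑ q : {xy : Fin (B'.get j).length × Fin (A.get i).length // ((A.get i).get xy.2).1 = ((B'.get j).get xy.1).1},
          (g (A.eraseIdx i ++ (B'.take j ++ LoopSeq.prune [negMerge _ q.1.1 _ q.1.2] ++ B'.drop (j + 1)) ++ B)
            - g (A.eraseIdx i ++ (B'.take j ++ LoopSeq.prune [posMerge _ q.1.1 _ q.1.2] ++ B'.drop (j + 1)) ++ B)))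
      + ∑ i : Fin B.length,
        ∑ q : {xy : Fin (B'.get j).length × Fin (B.get i).length // ((B.get i).get xy.2).1 = ((B'.get j).get xy.1).1},
          (g (A ++ (B.eraseIdx i ++ (B'.take j ++ LoopSeq.prune [negMerge _ q.1.1 _ q.1.2] ++ B'.drop (j + 1))))
            - g (A ++ (B.eraseIdx i ++ (B'.take j ++ LoopSeq.prune [posMerge _ q.1.1 _ q.1.2] ++ B'.drop (j + 1))))) := by
    intro j
    have e := compSum_eraseIdx_append (M := R)
      (fun w => {xy : Fin (B'.get j).length × Fin w.length // (w.get xy.2).1 = ((B'.get j).get xy.1).1})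
      (fun w q u => g (u ++ (B'.take j ++ LoopSeq.prune [negMerge (B'.get j) q.1.1 w q.1.2] ++ B'.drop (j + 1)))
        - g (u ++ (B'.take j ++ LoopSeq.prune [posMerge (B'.get j) q.1.1 w q.1.2] ++ B'.drop (j + 1)))) A B
    rw [e]
    congr 1
    · refine Finset.sum_congr rfl fun i _ => Finset.sum_congr rfl fun q _ => ?_
      have hq : ((A.get i).get q.1.2).1 = ((B'.get j).get q.1.1).1 := q.2
      have gn : IsLoop (negMerge (B'.get j) q.1.1 (A.get i) q.1.2) :=
        Word.isLoop_negMerge (hB' _ (List.get_mem B' j)).1.1 (hA _ (List.get_mem A i)).1.1 hq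
      have gp : IsLoop (posMerge (B'.get j) q.1.1 (A.get i) q.1.2) :=
        Word.isLoop_posMerge (hB' _ (List.get_mem B' j)).1.1 (hA _ (List.get_mem A i)).1.1 hq
      have hgen : ∀ w, IsLoop w →
          IsLoopSeq (A.eraseIdx i ++ B ++ (B'.take j ++ LoopSeq.prune [w] ++ B'.drop (j + 1))) :=
        fun w hw => isLoopSeq_append (isLoopSeq_append (isLoopSeq_take_drop hA 0 i).2.2 hB)
          (isLoopSeq_append (isLoopSeq_append (isLoopSeq_take_drop hB' j 0).1 (isLoopSeq_prune_singleton hw))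
            (isLoopSeq_take_drop hB' (j + 1) 0).2.1)
      have hperm : ∀ w : List (DEdge d), (A.eraseIdx i ++ B ++ (B'.take j ++ LoopSeq.prune [w] ++ B'.drop (j + 1))).Perm
          (A.eraseIdx i ++ (B'.take j ++ LoopSeq.prune [w] ++ B'.drop (j + 1)) ++ B) := by
        intro w
        have hc : (B ++ (B'.take j ++ (LoopSeq.prune [w] ++ B'.drop (j + 1)))).Perm
            (B'.take j ++ (LoopSeq.prune [w] ++ (B'.drop (j + 1) ++ B))) := by
          have h := List.perm_append_comm (l₁ := B) (l₂ := B'.take j ++ (LoopSeq.prune [w] ++ B'.drop (j + 1)))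
          simpa only [List.append_assoc] using h
        simp only [List.append_assoc]
        exact hc.append_left _
      rw [hg _ _ (hgen _ gn) (hperm _), hg _ _ (hgen _ gp) (hperm _)]
    · refine Finset.sum_congr rfl fun i _ => Finset.sum_congr rfl fun q _ => ?_
      simp only [List.append_assoc]
  rw [h1, Finset.sum_congr rfl fun j _ => h2 j, Finset.sum_add_distrib]
  abel

end ops

/-! ## Peeling the first centered block in block-indexed sums -/

/-- Block-indexed operator sums of `C :: rest`: the block `C` plus the blocks of `rest` (with `C` kept in front).
[folklore] -/
theorem blockSum_cons (Φ : LoopSeq d → (LoopSeq d → R) → R) (H : List (LoopSeq d) → R) (C : LoopSeq d)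
    (rest : List (LoopSeq d)) :
    (∑ j : Fin (C :: rest).length, Φ ((C :: rest).get j) (fun C' => H ((C :: rest).set j C'))) =
      Φ C (fun C' => H (C' :: rest)) + ∑ j : Fin rest.length, Φ (rest.get j) (fun C' => H (C :: rest.set j C')) := by
  refine (Fin.sum_univ_succ (fun j : Fin (rest.length + 1) =>
    Φ ((C :: rest).get j) (fun C' => H ((C :: rest).set j C')))).trans ?_
  rfl

/-- Block-indexed cross-merger sums of `C :: rest` against the uncentered block. [folklore] -/
theorem xmSum_cons (XMf : LoopSeq d → LoopSeq d → (LoopSeq d → R) → R) (H : LoopSeq d → List (LoopSeq d) → R)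
    (B₀ C : LoopSeq d) (rest : List (LoopSeq d)) :
    (∑ j : Fin (C :: rest).length, XMf B₀ ((C :: rest).get j) (fun M => H M ((C :: rest).eraseIdx j))) =
      XMf B₀ C (fun M => H M rest) + ∑ j : Fin rest.length, XMf B₀ (rest.get j) (fun M => H M (C :: rest.eraseIdx j)) := by
  refine (Fin.sum_univ_succ (fun j : Fin (rest.length + 1) =>
    XMf B₀ ((C :: rest).get j) (fun M => H M ((C :: rest).eraseIdx j)))).trans ?_
  rfl

/-- The ordered double sum over pairs of blocks `j < j'` of `C :: rest`: the pairs `(C, rest_{j'})` plus the pairs inside `rest`.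
[folklore] -/
theorem doubleSum_cons (C : LoopSeq d) (rest : List (LoopSeq d)) (T : Fin (C :: rest).length → Fin (C :: rest).length → R) :
    (∑ j : Fin (C :: rest).length, ∑ j' : Fin (C :: rest).length, if (j : ℕ) < j' then T j j' else 0) =
      (∑ j' : Fin rest.length, T 0 j'.succ) +
        ∑ j : Fin rest.length, ∑ j' : Fin rest.length, if (j : ℕ) < j' then T j.succ j'.succ else 0 := by
  refine (Fin.sum_univ_succ (fun j : Fin (rest.length + 1) =>
    ∑ j' : Fin (C :: rest).length, if (j : ℕ) < j' then T j j' else 0)).trans ?_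
  congr 1
  · refine (Fin.sum_univ_succ (fun j' : Fin (rest.length + 1) =>
      if ((0 : Fin (rest.length + 1)) : ℕ) < j' then T 0 j' else 0)).trans ?_
    rw [if_neg (lt_irrefl _), zero_add]
    refine Finset.sum_congr rfl fun j' _ => ?_
    rw [if_pos (by simp [Fin.val_succ])]
  · refine Finset.sum_congr rfl fun j _ => ?_
    refine (Fin.sum_univ_succ (fun j' : Fin (rest.length + 1) =>
      if ((Fin.succ j : Fin (rest.length + 1)) : ℕ) < j' then T j.succ j' else 0)).trans ?_
    rw [if_neg (by simp [Fin.val_succ]), zero_add]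
    refine Finset.sum_congr rfl fun j' _ => ?_
    by_cases h : (j : ℕ) < j'
    · rw [if_pos h, if_pos (by simpa [Fin.val_succ] using h)]
    · rw [if_neg h, if_neg (by simpa [Fin.val_succ] using h)]

end StringDuality

end Summit.QuantumFields.GaugeBoot

end
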